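/-
Copyright (c) 2026 the pub-hodgecm-mathlib formalisation cell (harness21).  Prover seat hodgecm-mathlib-F0P2-p07 (g2): Track B «K2-LIT»,
hLiu418 = stmt-HodgeConjecture-24832; (σ-A) road desk K2Liu-p25 (g3) WORD #51 (C) «print the vector AT A POINT in the SPLIT FORM Θ(u) = ψ(qf u) · G₀ u»
(LEAD F0P6-plan (g15∕g16) BATCH #253 (b)); consumer K2Liu-p08 (g6) (an-3) `hcone_of_stages` ζ-stage.
-/
import Summits.HodgeConjecture.HodgeConjecture.Theorems.K2LiuLocalSWCornerVectorAtPoint        -- ★ p864761 ∕ p865053 (W-w₂)@POINT §1–§2: the y-stage VECTOR word in the `j̃(p₁,p₂)`-model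
import Summits.HodgeConjecture.HodgeConjecture.Theorems.K2LiuLocalPiPartialFourierSplitting   -- ★ [A2] `coe_boxEquivSB_fourierOpPi_refl_apply_glue` (the `ι₁`-block Fourier operator read pointwise)
import HarnessLib

/-!
# Crux `HLiu418`, #42S block D row D-2, (σ-A) brick (W-w₂)@POINT — READ AT A POINT: the y-stage vector `op(j̃)(ω(s_T(w₁ · q · n(t) · g)) Ψ)` at `q₁ ⊔ q₂`
# is `γ · ∫_{X₁} ψ_v(x₁ ⬝ᵥ q₁) · Θ(x₁ ⊔ q₂) dx₁`, `Θ = (leviOpPi B₁ ⊠ 1)(unipOpPi c_{A t D⁻¹} vec_{q g})`, in the SPLIT FORM `Θ(u) = ψ_v(qf u′) · G₀(u′)`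

Cell `hodgecm-mathlib`, crux item hLiu418 = `stmt-HodgeConjecture-24832`; squad K2 ∕ K2Liu; prover F0P2-p07 (g2).  THEOREMS ONLY (no `def`, no instance,
no notation, no named-fact hypothesis, no `sorry`); lane `--supports stmt-HodgeConjecture-24832 --as helper` (count-neutral helper).  Sibling of ★
`K2LiuLocalSWCornerVectorAtPoint` (kept ≤ 400 lines; this file only READS its §2 at a point).

WHY.  The (σ-A) chain for `N₂val(x)` (K2Liu-p08 (g6) (an-3)) feeds the y-stage vector word ★ `exists_toOp_boxLoc_localSplitting_flip_siegel_nElem_mul_eq_smul_boxEquivSB`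
(`op(j̃)(ω(s_T(w₁ · q · n(t) · g)) Ψ) = γ • ((𝓕 ∘ leviOpPi B₁) ⊠ 1)(unipOpPi c_{A t D⁻¹} vec_{q g})`) into the ζ-stage AT A POINT `q₁ ⊔ q₂ = glue (blkIdx n₁ n₂) q₁ q₂`,
and wants the integrand in the SPLIT FORM `Θ(u) = ψ_v(qf u) · G₀ u` — a `t`-LINEAR second-degree phase `qf` (Rao's `halfForm` of `c_{A t D⁻¹}`) times a `t`-FREE
amplitude `G₀` (`|det B₁|_v^{-1/2} · vec_{q g}` pulled back by `B₁⁻¹` on the `X₁`-slot) — so that its step (C) is zero lines.  NO new mathematics: the box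
calculus ★ `boxEquivSB_mul` (`(M₁M₁') ⊠ 1 = (M₁ ⊠ 1)(M₁' ⊠ 1)`), ★ [A2]'s pointwise partial Fourier transform, the left-slot slice formula ★ `coe_sumEndSB_id_apply_glue`
(`((M ⊠ 1) f)(a ⊔ b) = (M f(· ⊔ b))(a)`, ★ `boxEquivSB_refl_apply`) and Rao's pointwise formulas ★ `coe_leviOpPi_apply` (`(leviOpPi a f)(u) = |det a|^{-1/2} f(a⁻¹u)`),
★ `coe_unipOpPi_apply` (`(unipOpPi c f)(u) = ψ(-½⟨u, c u⟩) f(u)`).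
* §1 (model-free, any `U`, `Θ₀ ∈ 𝒮`, any `B₁ ∈ GL`, any `c`): `coe_smul_boxEquivSB_fourierOpPi_mul_leviOpPi_refl_apply_glue`, `coe_boxEquivSB_leviOpPi_refl_unipOpPi_apply_glue`
  (THE SPLIT FORM), `coe_smul_boxEquivSB_fourierOpPi_mul_leviOpPi_refl_unipOpPi_apply_glue` (composite).
* §2 ★ **`exists_coe_toOp_boxLoc_localSplitting_flip_siegel_nElem_mul_apply_glue`** (`Θ ∈ 𝒮` named — for Fubini ∕ inversion downstream) and
  ★ **`exists_coe_toOp_boxLoc_localSplitting_flip_siegel_nElem_mul_apply_glue_split`** (phase and amplitude printed in place), SAME unit `γ` as ★ (W-w₂)@POINT §2, uniform in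
  `t, q, g, Ψ, q₁, q₂`.
HONEST LABEL.  Count-neutral helper: `HC_CM` is proved only modulo the 7 printed citations (2 remaining named inputs: hLiu418 = `stmt-HodgeConjecture-24832`,
h413 = `stmt-HodgeConjecture-24833`) until rung 0 closes; `hcone`∕`hZ` stay BY VALUE (R2) per M-160f until (an-1)–(an-3) ★.

## References
* [Kudla1994] S. S. Kudla, Israel J. Math. 87 (1994), §3 Thm. 3.1.   * [Rangarao1993] R. Ranga Rao, Pacific J. Math. 157 (1993), §3.1 (3.9), Lemma 3.2, p. 351.
* [MoeglinVignerasWaldspurger1987] C. Mœglin, M.-F. Vignéras, J.-L. Waldspurger, LNM 1291 (1987), Chap. 2 II.1 Rem. (6), II.6.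
* [Weil1964] A. Weil, Acta Math. 111 (1964), n° 13 (16), p. 160.
-/

set_option autoImplicit false
set_option linter.dupNamespace false -- the mandated namespace repeats `HodgeConjecture.HodgeConjecture`

noncomputable section

open scoped Matrix
open NumberField IsDedekindDomain MeasureTheory MeasureTheory.Measure Matrix
open Literature.RepresentationTheory.HeisenbergGroup Literature.RepresentationTheory.HeisenbergGroup.SymplecticMatrix
open Literature.NumberTheory.Automorphic Literature.NumberTheory.Automorphic.UnitaryGroup Literature.NumberTheory.Weil1964
open Literature.NumberTheory.GaloisRepresentations Literature.NumberTheory.GaloisRepresentations.IsNonarchimedeanLocalField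
open Literature.RepresentationTheory.HarrisKudlaSweet1996
open Literature.NumberTheory.GelbartRogawski1991.UnitaryDualPair
open Literature.NumberTheory.GelbartRogawski1991.UnitaryDualPair.LocalSplitting
open Literature.NumberTheory.GelbartRogawski1991.AdaptedBlocks
open Literature.NumberTheory.GelbartRogawski1991.UnitaryDualPair.LocalSplitting.DoubledBlock
open Summit.HodgeConjecture.HodgeConjecture.Cruxes.HLiu418.K2LiuLocalSWSectionDefs
open Summit.HodgeConjecture.HodgeConjecture.Cruxes.HLiu418.K2LiuLocalSWBigCellWords
open Summit.HodgeConjecture.HodgeConjecture.Cruxes.HLiu418.K2LiuLocalSWMiddleCellFunctional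
open Summit.HodgeConjecture.HodgeConjecture.Cruxes.HLiu418.K2LiuLocalPiPartialFourierSplitting (coe_boxEquivSB_fourierOpPi_refl_apply_glue)
open Summit.HodgeConjecture.HodgeConjecture.Cruxes.HLiu418.K2LiuLocalSWCornerVectorAtPoint (exists_toOp_boxLoc_localSplitting_flip_siegel_nElem_mul_eq_smul_boxEquivSB)

namespace Summit.HodgeConjecture.HodgeConjecture.Cruxes.HLiu418.K2LiuLocalSWCornerVectorAtPointSplit

variable (L : Type) [Field L] [NumberField L] [IsCMField L] (v : HeightOneSpectrum (𝓞 (maximalRealSubfield L)))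
  [MeasurableSpace (v.adicCompletion (maximalRealSubfield L))] [BorelSpace (v.adicCompletion (maximalRealSubfield L))]
  (μ : Measure (v.adicCompletion (maximalRealSubfield L))) [μ.IsAddHaarMeasure]
  (n₁ n₂ : ℕ) {T₁ : Matrix (Fin n₁) (Fin n₁) (maximalRealSubfield L)} {T₂ : Matrix (Fin n₂) (Fin n₂) (maximalRealSubfield L)}
  (hT₁ : T₁.IsSymm) (hT₂ : T₂.IsSymm) (hT₁d : IsUnit T₁.det) (hT₂d : IsUnit T₂.det)
  (χ : HeckeCharacter L) (hχ : IsSplittingChar L 1 χ)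

/-! ## §1 Model-free pointwise lemmas: `((𝓕 · leviOpPi B₁) ⊠ 1)` splits and reads at `q₁ ⊔ q₂`; the split form of `(leviOpPi B₁ ⊠ 1)(unipOpPi c Θ₀)` -/

omit [IsCMField L] in
/-- **`(𝓕 ∘ leviOpPi B₁) ⊠ 1` SPLITS AND READS POINTWISE** (no model, any `U ∈ 𝒮`): `(γ • ((𝓕 · leviOpPi B₁) ⊠ 1) U)(q₁ ⊔ q₂) = γ · ∫ ψ_v(x₁ ⬝ᵥ q₁) ((leviOpPi B₁ ⊠ 1) U)(x₁ ⊔ q₂) dμ^{⊗}(x₁)`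
— ★ `boxEquivSB_mul` (`(M₁M₁') ⊠ 1 = (M₁ ⊠ 1)(M₁' ⊠ 1)`) and ★ [A2] `coe_boxEquivSB_fourierOpPi_refl_apply_glue` (the `ι₁`-block Fourier operator read pointwise).
[cite: MoeglinVignerasWaldspurger1987, Chap. 2 II.1 Rem. (6), II.6] [cite: Rangarao1993, §3.1 (3.9)] -/
theorem coe_smul_boxEquivSB_fourierOpPi_mul_leviOpPi_refl_apply_glue {m : ℤ} (hm : (adeleAddCharAt (maximalRealSubfield L) v).HasConductorExp m)
    (γ : ℂ) (B₁ : GL (Fin (n₁ + n₁)) (v.adicCompletion (maximalRealSubfield L)))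
    (U : SchwartzBruhat (Fin ((n₁ + n₂) + (n₁ + n₂)) → v.adicCompletion (maximalRealSubfield L)))
    (q₁ : Fin (n₁ + n₁) → v.adicCompletion (maximalRealSubfield L)) (q₂ : Fin (n₂ + n₂) → v.adicCompletion (maximalRealSubfield L)) :
    ((γ • boxEquivSB (v.adicCompletion (maximalRealSubfield L)) (blkIdx n₁ n₂)
          (fourierOpPi μ (isContinuousNontrivial_adeleAddCharAt (maximalRealSubfield L) v) hm * leviOpPi (glEquiv B₁)) (LinearEquiv.refl ℂ _) U :
        SchwartzBruhat (Fin ((n₁ + n₂) + (n₁ + n₂)) → v.adicCompletion (maximalRealSubfield L))) :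
        (Fin ((n₁ + n₂) + (n₁ + n₂)) → v.adicCompletion (maximalRealSubfield L)) → ℂ) (glue (blkIdx n₁ n₂) q₁ q₂) =
      γ * ∫ x₁, ((adeleAddCharAt (maximalRealSubfield L) v (x₁ ⬝ᵥ q₁) : Circle) : ℂ) *
        ((boxEquivSB (v.adicCompletion (maximalRealSubfield L)) (blkIdx n₁ n₂) (leviOpPi (glEquiv B₁)) (LinearEquiv.refl ℂ _) U :
            SchwartzBruhat (Fin ((n₁ + n₂) + (n₁ + n₂)) → v.adicCompletion (maximalRealSubfield L))) :
            (Fin ((n₁ + n₂) + (n₁ + n₂)) → v.adicCompletion (maximalRealSubfield L)) → ℂ) (glue (blkIdx n₁ n₂) x₁ q₂) ∂(Measure.pi fun _ : Fin (n₁ + n₁) => μ) := by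
  have hbox : boxEquivSB (v.adicCompletion (maximalRealSubfield L)) (blkIdx n₁ n₂)
        (fourierOpPi μ (isContinuousNontrivial_adeleAddCharAt (maximalRealSubfield L) v) hm * leviOpPi (glEquiv B₁))
        (LinearEquiv.refl ℂ (SchwartzBruhat (Fin (n₂ + n₂) → v.adicCompletion (maximalRealSubfield L)))) =
      boxEquivSB (v.adicCompletion (maximalRealSubfield L)) (blkIdx n₁ n₂)
          (fourierOpPi μ (isContinuousNontrivial_adeleAddCharAt (maximalRealSubfield L) v) hm) (LinearEquiv.refl ℂ _) *
        boxEquivSB (v.adicCompletion (maximalRealSubfield L)) (blkIdx n₁ n₂) (leviOpPi (glEquiv B₁)) (LinearEquiv.refl ℂ _) := by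
    rw [← boxEquivSB_mul]
    rfl
  rw [Submodule.coe_smul, Pi.smul_apply, smul_eq_mul, hbox, LinearEquiv.mul_apply, coe_boxEquivSB_fourierOpPi_refl_apply_glue]

omit [IsCMField L] [MeasurableSpace (v.adicCompletion (maximalRealSubfield L))] [BorelSpace (v.adicCompletion (maximalRealSubfield L))] in
/-- **`(leviOpPi B₁ ⊠ 1)(unipOpPi c Θ₀)` READ POINTWISE — THE SPLIT FORM `Θ(u) = |det B₁|_v^{-1/2} · ψ_v(-½⟨u′, c u′⟩) · Θ₀(u′)`, `u′ = (B₁⁻¹ x₁) ⊔ q₂` for `u = x₁ ⊔ q₂`**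
(no model, any `Θ₀ ∈ 𝒮`, any `c`): ★ `boxEquivSB_refl_apply` + the left-slot slice formula ★ `coe_sumEndSB_id_apply_glue` + Rao ★ `coe_leviOpPi_apply`, ★ `coe_unipOpPi_apply`.
[cite: Rangarao1993, Lemma 3.2 (1)–(2), (3.8), p. 351] [cite: MoeglinVignerasWaldspurger1987, Chap. 2 II.1 Rem. (6)] -/
theorem coe_boxEquivSB_leviOpPi_refl_unipOpPi_apply_glue (B₁ : GL (Fin (n₁ + n₁)) (v.adicCompletion (maximalRealSubfield L)))
    (c : (Fin ((n₁ + n₂) + (n₁ + n₂)) → v.adicCompletion (maximalRealSubfield L)) →ₗ[v.adicCompletion (maximalRealSubfield L)]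
      (Fin ((n₁ + n₂) + (n₁ + n₂)) → v.adicCompletion (maximalRealSubfield L)))
    (Θ₀ : SchwartzBruhat (Fin ((n₁ + n₂) + (n₁ + n₂)) → v.adicCompletion (maximalRealSubfield L)))
    (x₁ : Fin (n₁ + n₁) → v.adicCompletion (maximalRealSubfield L)) (q₂ : Fin (n₂ + n₂) → v.adicCompletion (maximalRealSubfield L)) :
    ((boxEquivSB (v.adicCompletion (maximalRealSubfield L)) (blkIdx n₁ n₂) (leviOpPi (glEquiv B₁)) (LinearEquiv.refl ℂ _)
          (unipOpPi (isLocallyConstant_of_isContinuousNontrivial (isContinuousNontrivial_adeleAddCharAt (maximalRealSubfield L) v)) c Θ₀) :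
        SchwartzBruhat (Fin ((n₁ + n₂) + (n₁ + n₂)) → v.adicCompletion (maximalRealSubfield L))) :
        (Fin ((n₁ + n₂) + (n₁ + n₂)) → v.adicCompletion (maximalRealSubfield L)) → ℂ) (glue (blkIdx n₁ n₂) x₁ q₂) =
      ((modSqrt (glEquiv B₁) : ℝ) : ℂ)⁻¹ *
        (((adeleAddCharAt (maximalRealSubfield L) v
              (-halfForm c (glue (blkIdx n₁ n₂) (((B₁⁻¹ : GL (Fin (n₁ + n₁)) (v.adicCompletion (maximalRealSubfield L))) :
                Matrix (Fin (n₁ + n₁)) (Fin (n₁ + n₁)) (v.adicCompletion (maximalRealSubfield L))) *ᵥ x₁) q₂)) : Circle) : ℂ) *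
          (Θ₀ : (Fin ((n₁ + n₂) + (n₁ + n₂)) → v.adicCompletion (maximalRealSubfield L)) → ℂ)
            (glue (blkIdx n₁ n₂) (((B₁⁻¹ : GL (Fin (n₁ + n₁)) (v.adicCompletion (maximalRealSubfield L))) :
              Matrix (Fin (n₁ + n₁)) (Fin (n₁ + n₁)) (v.adicCompletion (maximalRealSubfield L))) *ᵥ x₁) q₂)) := by
  rw [boxEquivSB_refl_apply, coe_sumEndSB_id_apply_glue, LinearEquiv.coe_coe, coe_leviOpPi_apply, glEquiv_symm_apply]
  -- the left-slot slice of `unipOpPi c Θ₀` at `B₁⁻¹ x₁` is its value at `(B₁⁻¹ x₁) ⊔ q₂` (definitional), then Rao's formula for `r(n(c))`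
  exact congrArg (fun z : ℂ => ((modSqrt (glEquiv B₁) : ℝ) : ℂ)⁻¹ * z)
    (coe_unipOpPi_apply (isLocallyConstant_of_isContinuousNontrivial (isContinuousNontrivial_adeleAddCharAt (maximalRealSubfield L) v)) c Θ₀ _)

omit [IsCMField L] in
/-- **THE TWO STEPS COMBINED** (no model, any `Θ₀ ∈ 𝒮`): `(γ • ((𝓕 · leviOpPi B₁) ⊠ 1)(unipOpPi c Θ₀))(q₁ ⊔ q₂)
= γ · ∫ ψ_v(x₁ ⬝ᵥ q₁) · (|det B₁|_v^{-1/2} · ψ_v(-½⟨(B₁⁻¹x₁) ⊔ q₂, c((B₁⁻¹x₁) ⊔ q₂)⟩) · Θ₀((B₁⁻¹ x₁) ⊔ q₂)) dμ^{⊗}(x₁)`.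
[cite: Rangarao1993, §3.1 (3.9), Lemma 3.2] [cite: MoeglinVignerasWaldspurger1987, Chap. 2 II.1 Rem. (6), II.6] -/
theorem coe_smul_boxEquivSB_fourierOpPi_mul_leviOpPi_refl_unipOpPi_apply_glue {m : ℤ} (hm : (adeleAddCharAt (maximalRealSubfield L) v).HasConductorExp m)
    (γ : ℂ) (B₁ : GL (Fin (n₁ + n₁)) (v.adicCompletion (maximalRealSubfield L)))
    (c : (Fin ((n₁ + n₂) + (n₁ + n₂)) → v.adicCompletion (maximalRealSubfield L)) →ₗ[v.adicCompletion (maximalRealSubfield L)]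
      (Fin ((n₁ + n₂) + (n₁ + n₂)) → v.adicCompletion (maximalRealSubfield L)))
    (Θ₀ : SchwartzBruhat (Fin ((n₁ + n₂) + (n₁ + n₂)) → v.adicCompletion (maximalRealSubfield L)))
    (q₁ : Fin (n₁ + n₁) → v.adicCompletion (maximalRealSubfield L)) (q₂ : Fin (n₂ + n₂) → v.adicCompletion (maximalRealSubfield L)) :
    ((γ • boxEquivSB (v.adicCompletion (maximalRealSubfield L)) (blkIdx n₁ n₂)
          (fourierOpPi μ (isContinuousNontrivial_adeleAddCharAt (maximalRealSubfield L) v) hm * leviOpPi (glEquiv B₁)) (LinearEquiv.refl ℂ _)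
          (unipOpPi (isLocallyConstant_of_isContinuousNontrivial (isContinuousNontrivial_adeleAddCharAt (maximalRealSubfield L) v)) c Θ₀) :
        SchwartzBruhat (Fin ((n₁ + n₂) + (n₁ + n₂)) → v.adicCompletion (maximalRealSubfield L))) :
        (Fin ((n₁ + n₂) + (n₁ + n₂)) → v.adicCompletion (maximalRealSubfield L)) → ℂ) (glue (blkIdx n₁ n₂) q₁ q₂) =
      γ * ∫ x₁, ((adeleAddCharAt (maximalRealSubfield L) v (x₁ ⬝ᵥ q₁) : Circle) : ℂ) *
        (((modSqrt (glEquiv B₁) : ℝ) : ℂ)⁻¹ *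
          (((adeleAddCharAt (maximalRealSubfield L) v
                (-halfForm c (glue (blkIdx n₁ n₂) (((B₁⁻¹ : GL (Fin (n₁ + n₁)) (v.adicCompletion (maximalRealSubfield L))) :
                  Matrix (Fin (n₁ + n₁)) (Fin (n₁ + n₁)) (v.adicCompletion (maximalRealSubfield L))) *ᵥ x₁) q₂)) : Circle) : ℂ) *
            (Θ₀ : (Fin ((n₁ + n₂) + (n₁ + n₂)) → v.adicCompletion (maximalRealSubfield L)) → ℂ)
              (glue (blkIdx n₁ n₂) (((B₁⁻¹ : GL (Fin (n₁ + n₁)) (v.adicCompletion (maximalRealSubfield L))) :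
                Matrix (Fin (n₁ + n₁)) (Fin (n₁ + n₁)) (v.adicCompletion (maximalRealSubfield L))) *ᵥ x₁) q₂))) ∂(Measure.pi fun _ : Fin (n₁ + n₁) => μ) := by
  rw [coe_smul_boxEquivSB_fourierOpPi_mul_leviOpPi_refl_apply_glue]
  simp only [coe_boxEquivSB_leviOpPi_refl_unipOpPi_apply_glue]

/-! ## §2 ★ (W-w₂)@POINT READ AT A POINT `q₁ ⊔ q₂` — (C) of the (σ-A) ζ-stage: `Θ ∈ 𝒮` named, and the fully explicit SPLIT FORM -/

include hT₁d in
set_option maxHeartbeats 4000000 in -- MEASURED 2026-09-05: 200 000 ∕ 1 000 000 ∕ 2 000 000 ✗ (`isDefEq`∕`whnf` on the doubled CM telescope in `rw [hγ]; exact`), 4 000 000 ✓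
/-- ★ **(W-w₂)@POINT READ AT A POINT — (C) for the ζ-stage.**  With ★ (W-w₂)@POINT §2's data (`exists_toOp_boxLoc_localSplitting_flip_siegel_nElem_mul_eq_smul_boxEquivSB`) and ITS unit `γ`, for every skew `t`, Siegel `q`, `g`, `Ψ` and every point
`q₁ ⊔ q₂ = glue (blkIdx n₁ n₂) q₁ q₂`:  `(op(j̃)(ω(s_T(w₁ · q · n(t) · g)) Ψ))(q₁ ⊔ q₂) = γ · ∫_{X₁} ψ_v(x₁ ⬝ᵥ q₁) · Θ(x₁ ⊔ q₂) dμ^{⊗(n₁+n₁)}(x₁)`, the Schwartz–Bruhat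
function `Θ := (leviOpPi B₁ ⊠ 1)(unipOpPi c_{A t D⁻¹} vec_{q g}) ∈ 𝒮`, `vec_{q g} = op(j̃)(ω(s_T(q · g)) Ψ)` — ★ §2 read through ★ `boxEquivSB_mul` and ★ [A2]
`coe_boxEquivSB_fourierOpPi_refl_apply_glue` (`coe_smul_boxEquivSB_fourierOpPi_mul_leviOpPi_refl_apply_glue`); `Θ`'s SPLIT FORM is `coe_boxEquivSB_leviOpPi_refl_unipOpPi_apply_glue`
and the fully explicit reading is the next theorem.
[cite: Kudla1994, §3 Thm. 3.1] [cite: Rangarao1993, §3.1 (3.9), Lemma 3.2 (3.8)] [cite: MoeglinVignerasWaldspurger1987, Chap. 2 II.1 Rem. (6), II.6] [cite: Weil1964, n° 13 (16), p. 160] -/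
theorem exists_coe_toOp_boxLoc_localSplitting_flip_siegel_nElem_mul_apply_glue (hn₁ : 0 < n₁) (t₁ : Fin n₁ → maximalRealSubfield L)
    (hT₁t : T₁ = Matrix.diagonal t₁)
    (hTv₁ : IsUnit (localGram (maximalRealSubfield L) (n₁ + n₁) (gramD (maximalRealSubfield L) n₁ T₁) v).det)
    (p₁ : LocalMp (maximalRealSubfield L) (n₁ + n₁) (gramD (maximalRealSubfield L) n₁ T₁) v)
    (hp₁ : (deltaLagrangian (maximalRealSubfield L) v n₁).map (toLin (maximalRealSubfield L) v (MpPsi.proj _ p₁)) = lagrangianY (maximalRealSubfield L) (n₁ + n₁) v)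
    (B₁ : GL (Fin (n₁ + n₁)) (v.adicCompletion (maximalRealSubfield L)))
    (hW₁ : MpPsi.proj _ p₁ * iotaD (maximalRealSubfield L) L (IsCMField.complexConj L) (complexConj_imagUnit L) (imagUnit_ne_zero L)
        (imagUnit_mul_self L) v n₁ hT₁ rfl (weylDelta (maximalRealSubfield L) L (IsCMField.complexConj L) v n₁ (T₀ := T₁) rfl) * (MpPsi.proj _ p₁)⁻¹ =
      (transportSp (localGram (maximalRealSubfield L) (n₁ + n₁) (gramD (maximalRealSubfield L) n₁ T₁) v) hTv₁ (SymplecticGroup.symJ _ _))⁻¹ *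
        transportSp (localGram (maximalRealSubfield L) (n₁ + n₁) (gramD (maximalRealSubfield L) n₁ T₁) v) hTv₁ (levi B₁))
    {m : ℤ} (hm : (adeleAddCharAt (maximalRealSubfield L) v).HasConductorExp m)
    (p₂ : LocalMp (maximalRealSubfield L) (n₂ + n₂) (gramD (maximalRealSubfield L) n₂ T₂) v)
    (hp₂ : (deltaLagrangian (maximalRealSubfield L) v n₂).map (toLin (maximalRealSubfield L) v (MpPsi.proj _ p₂)) = lagrangianY (maximalRealSubfield L) (n₂ + n₂) v) :
    ∃ γ : ℂˣ, ∀ (t : Matrix (Fin (n₁ + n₂)) (Fin (n₁ + n₂)) (LocalRing L v))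
      (ht : (t.map (conjLocal L (IsCMField.complexConj L) v))ᵀ * gramS (maximalRealSubfield L) L v (n₁ + n₂) (UnitaryGroup.finSum n₁ n₂ T₁ T₂) +
        gramS (maximalRealSubfield L) L v (n₁ + n₂) (UnitaryGroup.finSum n₁ n₂ T₁ T₂) * t = 0)
      (q : UnitaryGroup.localPi L (IsCMField.complexConj L) ((n₁ + n₂) + (n₁ + n₂))
        ((gramD (maximalRealSubfield L) (n₁ + n₂) (UnitaryGroup.finSum n₁ n₂ T₁ T₂)).map (algebraMap (maximalRealSubfield L) L)) v)
      (hqC : blkC (matA (maximalRealSubfield L) L (IsCMField.complexConj L) v (n₁ + n₂) q) = 0)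
      (hAtD : ((blkA (matA (maximalRealSubfield L) L (IsCMField.complexConj L) v (n₁ + n₂) q) * t *
            (blkD (matA (maximalRealSubfield L) L (IsCMField.complexConj L) v (n₁ + n₂) q))⁻¹).map (conjLocal L (IsCMField.complexConj L) v))ᵀ *
          gramS (maximalRealSubfield L) L v (n₁ + n₂) (UnitaryGroup.finSum n₁ n₂ T₁ T₂) +
        gramS (maximalRealSubfield L) L v (n₁ + n₂) (UnitaryGroup.finSum n₁ n₂ T₁ T₂) *
          (blkA (matA (maximalRealSubfield L) L (IsCMField.complexConj L) v (n₁ + n₂) q) * t *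
            (blkD (matA (maximalRealSubfield L) L (IsCMField.complexConj L) v (n₁ + n₂) q))⁻¹) = 0)
      (g : UnitaryGroup.localPi L (IsCMField.complexConj L) ((n₁ + n₂) + (n₁ + n₂))
        ((gramD (maximalRealSubfield L) (n₁ + n₂) (UnitaryGroup.finSum n₁ n₂ T₁ T₂)).map (algebraMap (maximalRealSubfield L) L)) v)
      (Ψ : SchwartzBruhat (Fin ((n₁ + n₂) + (n₁ + n₂)) → v.adicCompletion (maximalRealSubfield L)))
      (q₁ : Fin (n₁ + n₁) → v.adicCompletion (maximalRealSubfield L)) (q₂ : Fin (n₂ + n₂) → v.adicCompletion (maximalRealSubfield L)),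
      ((MpPsi.toOp _ (boxLoc (maximalRealSubfield L) v n₁ n₂ (T₁ := T₁) (T₂ := T₂) (p₁, p₂))
          (MpPsi.toRep (localSchrodinger (maximalRealSubfield L) ((n₁ + n₂) + (n₁ + n₂))
            (gramD (maximalRealSubfield L) (n₁ + n₂) (UnitaryGroup.finSum n₁ n₂ T₁ T₂)) v)
            ((localSplittingDatumCM L v μ (n₁ + n₂) (UnitaryGroup.isSymm_finSum hT₁ hT₂) (isUnit_det_finSum L n₁ n₂ hT₁d hT₂d) rfl χ hχ).localSplitting
              (blkLoc (maximalRealSubfield L) L (IsCMField.complexConj L) v n₁ n₂ (T₁ := T₁) (T₂ := T₂) rfl rfl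
                  (weylDelta (maximalRealSubfield L) L (IsCMField.complexConj L) v n₁ (T₀ := T₁) rfl) * q *
                nElem (maximalRealSubfield L) L (IsCMField.complexConj L) v (n₁ + n₂) (T₀ := UnitaryGroup.finSum n₁ n₂ T₁ T₂) rfl t ht * g)) Ψ) :
        SchwartzBruhat (Fin ((n₁ + n₂) + (n₁ + n₂)) → v.adicCompletion (maximalRealSubfield L))) : (Fin ((n₁ + n₂) + (n₁ + n₂)) → v.adicCompletion (maximalRealSubfield L)) → ℂ) (glue (blkIdx n₁ n₂) q₁ q₂) =
        (γ : ℂ) * ∫ x₁, ((adeleAddCharAt (maximalRealSubfield L) v (x₁ ⬝ᵥ q₁) : Circle) : ℂ) *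
          ((boxEquivSB (v.adicCompletion (maximalRealSubfield L)) (blkIdx n₁ n₂) (leviOpPi (glEquiv B₁)) (LinearEquiv.refl ℂ _)
          (unipOpPi (isLocallyConstant_of_isContinuousNontrivial (isContinuousNontrivial_adeleAddCharAt (maximalRealSubfield L) v))
            (Matrix.mulVecLin (cOfFix (localGram (maximalRealSubfield L) ((n₁ + n₂) + (n₁ + n₂)) (gramD (maximalRealSubfield L) (n₁ + n₂) (UnitaryGroup.finSum n₁ n₂ T₁ T₂)) v)
              (MpPsi.proj _ (boxLoc (maximalRealSubfield L) v n₁ n₂ (T₁ := T₁) (T₂ := T₂) (p₁, p₂)) *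
                iotaD (maximalRealSubfield L) L (IsCMField.complexConj L) (complexConj_imagUnit L) (imagUnit_ne_zero L) (imagUnit_mul_self L) v
                  (n₁ + n₂) (UnitaryGroup.isSymm_finSum hT₁ hT₂) rfl
                  (nElem (maximalRealSubfield L) L (IsCMField.complexConj L) v (n₁ + n₂) (T₀ := UnitaryGroup.finSum n₁ n₂ T₁ T₂) rfl
                    (blkA (matA (maximalRealSubfield L) L (IsCMField.complexConj L) v (n₁ + n₂) q) * t *
                      (blkD (matA (maximalRealSubfield L) L (IsCMField.complexConj L) v (n₁ + n₂) q))⁻¹) hAtD) *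
                (MpPsi.proj _ (boxLoc (maximalRealSubfield L) v n₁ n₂ (T₁ := T₁) (T₂ := T₂) (p₁, p₂)))⁻¹)))
            (MpPsi.toOp _ (boxLoc (maximalRealSubfield L) v n₁ n₂ (T₁ := T₁) (T₂ := T₂) (p₁, p₂))
              (MpPsi.toRep (localSchrodinger (maximalRealSubfield L) ((n₁ + n₂) + (n₁ + n₂))
                (gramD (maximalRealSubfield L) (n₁ + n₂) (UnitaryGroup.finSum n₁ n₂ T₁ T₂)) v)
                ((localSplittingDatumCM L v μ (n₁ + n₂) (UnitaryGroup.isSymm_finSum hT₁ hT₂) (isUnit_det_finSum L n₁ n₂ hT₁d hT₂d) rfl χ hχ).localSplitting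
                  (q * g)) Ψ))) :
        SchwartzBruhat (Fin ((n₁ + n₂) + (n₁ + n₂)) → v.adicCompletion (maximalRealSubfield L))) : (Fin ((n₁ + n₂) + (n₁ + n₂)) → v.adicCompletion (maximalRealSubfield L)) → ℂ) (glue (blkIdx n₁ n₂) x₁ q₂) ∂(Measure.pi fun _ : Fin (n₁ + n₁) => μ) := by
  obtain ⟨γ, hγ⟩ := exists_toOp_boxLoc_localSplitting_flip_siegel_nElem_mul_eq_smul_boxEquivSB L v μ n₁ n₂ hT₁ hT₂ hT₁d hT₂d χ hχ hn₁ t₁ hT₁t hTv₁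
    p₁ hp₁ B₁ hW₁ hm p₂ hp₂
  refine ⟨γ, fun t ht q hqC hAtD g Ψ q₁ q₂ => ?_⟩
  rw [hγ t ht q hqC hAtD g Ψ]
  exact coe_smul_boxEquivSB_fourierOpPi_mul_leviOpPi_refl_apply_glue L v μ n₁ n₂ hm (γ : ℂ) B₁ _ q₁ q₂

include hT₁d in
set_option maxHeartbeats 4000000 in -- MEASURED 2026-09-05: 200 000 ∕ 2 000 000 ✗ (`isDefEq`∕`whnf` on the doubled CM telescope in `rw [hγ]; exact`), 4 000 000 ✓
/-- ★ **(W-w₂)@POINT READ AT A POINT, SPLIT FORM (fully explicit) — `Θ(u) = ψ_v(qf u) · G₀ u`.**  With ★ (W-w₂)@POINT §2's data and its unit `γ`: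
`(op(j̃)(ω(s_T(w₁ · q · n(t) · g)) Ψ))(q₁ ⊔ q₂) = γ · ∫_{X₁} ψ_v(x₁ ⬝ᵥ q₁) · (|det B₁|_v^{-1/2} · ψ_v(qf(u′)) · vec_{q g}(u′)) dμ^{⊗(n₁+n₁)}(x₁)`, `u′ = (B₁⁻¹ x₁) ⊔ q₂`,
with the DEFINING LETTERS printed in place: the second-degree phase `qf u′ = -½⟨u′, c_{A t D⁻¹} u′⟩` (Rao's `halfForm` of `c_{A t D⁻¹} = cOfFix 𝕋 (π(j̃) ι(n(A t D⁻¹)) π(j̃)⁻¹)`,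
LINEAR in `t`) and the amplitude `G₀ u′ = |det B₁|_v^{-1/2} · vec_{q g}(u′)`, `vec_{q g} = op(j̃)(ω(s_T(q · g)) Ψ)` (t-FREE) — so the (σ-A) consumer's (C) is zero lines.
[cite: Kudla1994, §3 Thm. 3.1] [cite: Rangarao1993, §3.1 (3.9), Lemma 3.2 (1)–(2), (3.8), p. 351] [cite: MoeglinVignerasWaldspurger1987, Chap. 2 II.1 Rem. (6), II.6] [cite: Weil1964, n° 13 (16), p. 160] -/
theorem exists_coe_toOp_boxLoc_localSplitting_flip_siegel_nElem_mul_apply_glue_split (hn₁ : 0 < n₁) (t₁ : Fin n₁ → maximalRealSubfield L)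
    (hT₁t : T₁ = Matrix.diagonal t₁)
    (hTv₁ : IsUnit (localGram (maximalRealSubfield L) (n₁ + n₁) (gramD (maximalRealSubfield L) n₁ T₁) v).det)
    (p₁ : LocalMp (maximalRealSubfield L) (n₁ + n₁) (gramD (maximalRealSubfield L) n₁ T₁) v)
    (hp₁ : (deltaLagrangian (maximalRealSubfield L) v n₁).map (toLin (maximalRealSubfield L) v (MpPsi.proj _ p₁)) = lagrangianY (maximalRealSubfield L) (n₁ + n₁) v)
    (B₁ : GL (Fin (n₁ + n₁)) (v.adicCompletion (maximalRealSubfield L)))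
    (hW₁ : MpPsi.proj _ p₁ * iotaD (maximalRealSubfield L) L (IsCMField.complexConj L) (complexConj_imagUnit L) (imagUnit_ne_zero L)
        (imagUnit_mul_self L) v n₁ hT₁ rfl (weylDelta (maximalRealSubfield L) L (IsCMField.complexConj L) v n₁ (T₀ := T₁) rfl) * (MpPsi.proj _ p₁)⁻¹ =
      (transportSp (localGram (maximalRealSubfield L) (n₁ + n₁) (gramD (maximalRealSubfield L) n₁ T₁) v) hTv₁ (SymplecticGroup.symJ _ _))⁻¹ *
        transportSp (localGram (maximalRealSubfield L) (n₁ + n₁) (gramD (maximalRealSubfield L) n₁ T₁) v) hTv₁ (levi B₁))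
    {m : ℤ} (hm : (adeleAddCharAt (maximalRealSubfield L) v).HasConductorExp m)
    (p₂ : LocalMp (maximalRealSubfield L) (n₂ + n₂) (gramD (maximalRealSubfield L) n₂ T₂) v)
    (hp₂ : (deltaLagrangian (maximalRealSubfield L) v n₂).map (toLin (maximalRealSubfield L) v (MpPsi.proj _ p₂)) = lagrangianY (maximalRealSubfield L) (n₂ + n₂) v) :
    ∃ γ : ℂˣ, ∀ (t : Matrix (Fin (n₁ + n₂)) (Fin (n₁ + n₂)) (LocalRing L v))
      (ht : (t.map (conjLocal L (IsCMField.complexConj L) v))ᵀ * gramS (maximalRealSubfield L) L v (n₁ + n₂) (UnitaryGroup.finSum n₁ n₂ T₁ T₂) +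
        gramS (maximalRealSubfield L) L v (n₁ + n₂) (UnitaryGroup.finSum n₁ n₂ T₁ T₂) * t = 0)
      (q : UnitaryGroup.localPi L (IsCMField.complexConj L) ((n₁ + n₂) + (n₁ + n₂))
        ((gramD (maximalRealSubfield L) (n₁ + n₂) (UnitaryGroup.finSum n₁ n₂ T₁ T₂)).map (algebraMap (maximalRealSubfield L) L)) v)
      (hqC : blkC (matA (maximalRealSubfield L) L (IsCMField.complexConj L) v (n₁ + n₂) q) = 0)
      (hAtD : ((blkA (matA (maximalRealSubfield L) L (IsCMField.complexConj L) v (n₁ + n₂) q) * t *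
            (blkD (matA (maximalRealSubfield L) L (IsCMField.complexConj L) v (n₁ + n₂) q))⁻¹).map (conjLocal L (IsCMField.complexConj L) v))ᵀ *
          gramS (maximalRealSubfield L) L v (n₁ + n₂) (UnitaryGroup.finSum n₁ n₂ T₁ T₂) +
        gramS (maximalRealSubfield L) L v (n₁ + n₂) (UnitaryGroup.finSum n₁ n₂ T₁ T₂) *
          (blkA (matA (maximalRealSubfield L) L (IsCMField.complexConj L) v (n₁ + n₂) q) * t *
            (blkD (matA (maximalRealSubfield L) L (IsCMField.complexConj L) v (n₁ + n₂) q))⁻¹) = 0)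
      (g : UnitaryGroup.localPi L (IsCMField.complexConj L) ((n₁ + n₂) + (n₁ + n₂))
        ((gramD (maximalRealSubfield L) (n₁ + n₂) (UnitaryGroup.finSum n₁ n₂ T₁ T₂)).map (algebraMap (maximalRealSubfield L) L)) v)
      (Ψ : SchwartzBruhat (Fin ((n₁ + n₂) + (n₁ + n₂)) → v.adicCompletion (maximalRealSubfield L)))
      (q₁ : Fin (n₁ + n₁) → v.adicCompletion (maximalRealSubfield L)) (q₂ : Fin (n₂ + n₂) → v.adicCompletion (maximalRealSubfield L)),
      ((MpPsi.toOp _ (boxLoc (maximalRealSubfield L) v n₁ n₂ (T₁ := T₁) (T₂ := T₂) (p₁, p₂))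
          (MpPsi.toRep (localSchrodinger (maximalRealSubfield L) ((n₁ + n₂) + (n₁ + n₂))
            (gramD (maximalRealSubfield L) (n₁ + n₂) (UnitaryGroup.finSum n₁ n₂ T₁ T₂)) v)
            ((localSplittingDatumCM L v μ (n₁ + n₂) (UnitaryGroup.isSymm_finSum hT₁ hT₂) (isUnit_det_finSum L n₁ n₂ hT₁d hT₂d) rfl χ hχ).localSplitting
              (blkLoc (maximalRealSubfield L) L (IsCMField.complexConj L) v n₁ n₂ (T₁ := T₁) (T₂ := T₂) rfl rfl
                  (weylDelta (maximalRealSubfield L) L (IsCMField.complexConj L) v n₁ (T₀ := T₁) rfl) * q *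
                nElem (maximalRealSubfield L) L (IsCMField.complexConj L) v (n₁ + n₂) (T₀ := UnitaryGroup.finSum n₁ n₂ T₁ T₂) rfl t ht * g)) Ψ) :
        SchwartzBruhat (Fin ((n₁ + n₂) + (n₁ + n₂)) → v.adicCompletion (maximalRealSubfield L))) : (Fin ((n₁ + n₂) + (n₁ + n₂)) → v.adicCompletion (maximalRealSubfield L)) → ℂ) (glue (blkIdx n₁ n₂) q₁ q₂) =
        (γ : ℂ) * ∫ x₁, ((adeleAddCharAt (maximalRealSubfield L) v (x₁ ⬝ᵥ q₁) : Circle) : ℂ) *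
          ((((modSqrt (glEquiv B₁) : ℝ) : ℂ)⁻¹ *
            (((adeleAddCharAt (maximalRealSubfield L) v
                  (-halfForm
                    (Matrix.mulVecLin (cOfFix (localGram (maximalRealSubfield L) ((n₁ + n₂) + (n₁ + n₂)) (gramD (maximalRealSubfield L) (n₁ + n₂) (UnitaryGroup.finSum n₁ n₂ T₁ T₂)) v)
              (MpPsi.proj _ (boxLoc (maximalRealSubfield L) v n₁ n₂ (T₁ := T₁) (T₂ := T₂) (p₁, p₂)) *
                iotaD (maximalRealSubfield L) L (IsCMField.complexConj L) (complexConj_imagUnit L) (imagUnit_ne_zero L) (imagUnit_mul_self L) v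
                  (n₁ + n₂) (UnitaryGroup.isSymm_finSum hT₁ hT₂) rfl
                  (nElem (maximalRealSubfield L) L (IsCMField.complexConj L) v (n₁ + n₂) (T₀ := UnitaryGroup.finSum n₁ n₂ T₁ T₂) rfl
                    (blkA (matA (maximalRealSubfield L) L (IsCMField.complexConj L) v (n₁ + n₂) q) * t *
                      (blkD (matA (maximalRealSubfield L) L (IsCMField.complexConj L) v (n₁ + n₂) q))⁻¹) hAtD) *
                (MpPsi.proj _ (boxLoc (maximalRealSubfield L) v n₁ n₂ (T₁ := T₁) (T₂ := T₂) (p₁, p₂)))⁻¹)))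
                    (glue (blkIdx n₁ n₂) (((B₁⁻¹ : GL (Fin (n₁ + n₁)) (v.adicCompletion (maximalRealSubfield L))) : Matrix (Fin (n₁ + n₁)) (Fin (n₁ + n₁)) (v.adicCompletion (maximalRealSubfield L))) *ᵥ x₁) q₂)) : Circle) : ℂ) *
              (((MpPsi.toOp _ (boxLoc (maximalRealSubfield L) v n₁ n₂ (T₁ := T₁) (T₂ := T₂) (p₁, p₂))
              (MpPsi.toRep (localSchrodinger (maximalRealSubfield L) ((n₁ + n₂) + (n₁ + n₂))
                (gramD (maximalRealSubfield L) (n₁ + n₂) (UnitaryGroup.finSum n₁ n₂ T₁ T₂)) v)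
                ((localSplittingDatumCM L v μ (n₁ + n₂) (UnitaryGroup.isSymm_finSum hT₁ hT₂) (isUnit_det_finSum L n₁ n₂ hT₁d hT₂d) rfl χ hχ).localSplitting
                  (q * g)) Ψ)) :
        SchwartzBruhat (Fin ((n₁ + n₂) + (n₁ + n₂)) → v.adicCompletion (maximalRealSubfield L))) : (Fin ((n₁ + n₂) + (n₁ + n₂)) → v.adicCompletion (maximalRealSubfield L)) → ℂ)
                (glue (blkIdx n₁ n₂) (((B₁⁻¹ : GL (Fin (n₁ + n₁)) (v.adicCompletion (maximalRealSubfield L))) : Matrix (Fin (n₁ + n₁)) (Fin (n₁ + n₁)) (v.adicCompletion (maximalRealSubfield L))) *ᵥ x₁) q₂)))) ∂(Measure.pi fun _ : Fin (n₁ + n₁) => μ) := by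
  obtain ⟨γ, hγ⟩ := exists_toOp_boxLoc_localSplitting_flip_siegel_nElem_mul_eq_smul_boxEquivSB L v μ n₁ n₂ hT₁ hT₂ hT₁d hT₂d χ hχ hn₁ t₁ hT₁t hTv₁
    p₁ hp₁ B₁ hW₁ hm p₂ hp₂
  refine ⟨γ, fun t ht q hqC hAtD g Ψ q₁ q₂ => ?_⟩
  rw [hγ t ht q hqC hAtD g Ψ]
  exact coe_smul_boxEquivSB_fourierOpPi_mul_leviOpPi_refl_unipOpPi_apply_glue L v μ n₁ n₂ hm (γ : ℂ) B₁ _ _ q₁ q₂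

end Summit.HodgeConjecture.HodgeConjecture.Cruxes.HLiu418.K2LiuLocalSWCornerVectorAtPointSplit

end
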